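import Mathlib

/-!
# C4LetterSymbol — typed shadow of the LETTER-DIAGONAL LAW and the BALANCED CAP (hsemireg-c4-1 g22, memo `C4-LDL-c4-1-g22.md`)

Token: `line stmt-HodgeConjecture-18881 Cruxes/BlochSeedDiscOne/Lines/birth.lean 814a6a70c14e831a stub_rung_pad4_seedAt`.

HONEST SCOPE.  Nothing in this file is proved toward HC ∕ HC_CM ∕ HC_AV ∕ №4 ∕ 26512 ∕ 18881 ∕ H2, and the registered stub
`stub_rung_pad4_seedAt` is not touched.  This is the LINEAR-ALGEBRA SHADOW of three pen statements of the memo: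

* THEOREM LDL (memo §1): on the display-induced part `F0 = F⁰Ext²_X(𝓔,𝓔)` of a lettered display, the B3♭-T♯ door
  `door = δc₄(𝓔(tH))` factors as `door y = M (symbol y)` through the CLASS SYMBOL `symbol : F0 → S = ⊕_κ H^{0,2}(X)` and the
  map-free SYMBOL MATRIX `M : S → T = H^{3,5}(X)` of the alphabet.  Here this factorisation is the field `law` of a structure;
  its consequences (N1)/(N2)/(CAP) are then kernel-checked one-liners (`eq_zero_of_symbol_eq_zero`, `eq_zero_of_M_symbol_eq_zero`,
  `finrank_F0_le_finrank_range_M`, `finrank_F0_le_of_cap`).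
* THEOREM BALANCED CAP (memo §2): for every balanced alphabet on `X = Π_{f<4} E_i × E_i` the symbol matrix has rank ≤ 996
  (= 4·45 + 6·136, the Künneth blocks), and = 992 / 984 / 996 on the alphabets of record (engine `symboldoor.py`); the arithmetic of
  these block sums and of the ambient dimensions is recorded by `decide`/`norm_num` (`cap_universal`, `cap_nullcone`, …).
* LEMMA NULL-RAY (memo §1.5): in a commutative ring, if `n * n = 0` then a cubic `q` is affine along the ray `x + λ n`, so three
  collinear letters on a null ray carry a 2-codimensional family of symbol vectors killed by every `Q_t` (`cubic_nullRay_affine`,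
  `nullRay_kernel₃`).

No `sorry`, no `axiom`, no `instance`, no `notation`, no `native_decide`, no `set_option`.
-/

namespace HSemireg.C4LetterSymbol

open Module

section Shadow

variable {K : Type*} [Field K]
variable {V S T : Type*} [AddCommGroup V] [Module K V] [AddCommGroup S] [Module K S] [AddCommGroup T] [Module K T]

/-- The LDL datum of a lettered display (memo §1): the door `door : V → T` on `V = Ext²_X(𝓔,𝓔)`, the display-induced
subspace `F0 ≤ V`, the class-symbol map `symbol : F0 → S` and the symbol matrix `M : S → T` of the alphabet, with the
LETTER-DIAGONAL LAW `door y = M (symbol y)` for `y ∈ F0`. -/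
structure LetterSymbolDatum (K V S T : Type*) [Field K] [AddCommGroup V] [Module K V] [AddCommGroup S] [Module K S]
    [AddCommGroup T] [Module K T] where
  /-- the B3♭-T♯ door `δc₄(𝓔(tH)) : Ext² → H^{3,5}` -/
  door : V →ₗ[K] T
  /-- the display-induced classes `F⁰Ext²` -/
  F0 : Submodule K V
  /-- the class symbol `y ↦ (s_κ(y))_κ` -/
  symbol : F0 →ₗ[K] S
  /-- the symbol matrix `(c_κ)_κ ↦ Σ_κ c_κ ∧ Q_t(κ)` -/
  M : S →ₗ[K] T
  /-- THEOREM LDL as a hypothesis: the door on `F0` factors through the symbol -/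
  law : ∀ y : F0, door (y : V) = M (symbol y)

namespace LetterSymbolDatum

variable (D : LetterSymbolDatum K V S T)

/-- The door restricted to `F0` is `M ∘ symbol`. -/
theorem door_comp_subtype : D.door ∘ₗ D.F0.subtype = D.M ∘ₗ D.symbol := by
  ext y
  simp [D.law]

/-- (N2) SYMBOL LAW: if the door is injective (door 3 holds), a display-induced class whose symbol vector is killed by the
symbol matrix is zero. -/
theorem eq_zero_of_M_symbol_eq_zero (hinj : Function.Injective D.door) (y : D.F0) (hy : D.M (D.symbol y) = 0) :
    y = 0 := by
  have h : D.door (y : V) = D.door 0 := by rw [D.law, hy, map_zero]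
  have h' : (y : V) = 0 := hinj h
  exact_mod_cast h'

/-- (N1) ZERO-SYMBOL LAW: if the door is injective, a display-induced class with zero symbol (e.g. an `F¹`-class, an
off-diagonal same-level class, a traceless `sl_m ⊗ H^{0,2}` class) is zero. -/
theorem eq_zero_of_symbol_eq_zero (hinj : Function.Injective D.door) (y : D.F0) (hy : D.symbol y = 0) : y = 0 :=
  D.eq_zero_of_M_symbol_eq_zero hinj y (by rw [hy, map_zero])

/-- Injective door ⇒ `M ∘ symbol` is injective on `F0`. -/
theorem injective_M_comp_symbol (hinj : Function.Injective D.door) : Function.Injective (D.M ∘ₗ D.symbol) := by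
  intro y y' h
  have h0 : D.M (D.symbol (y - y')) = 0 := by
    have : (D.M ∘ₗ D.symbol) (y - y') = 0 := by rw [map_sub, h, sub_self]
    simpa using this
  have := D.eq_zero_of_M_symbol_eq_zero hinj (y - y') h0
  exact sub_eq_zero.mp this

/-- Injective door ⇒ the symbol map itself is injective on `F0` (symbol-faithfulness is necessary). -/
theorem injective_symbol (hinj : Function.Injective D.door) : Function.Injective D.symbol := by
  intro y y' h
  exact D.injective_M_comp_symbol hinj (by simp [h])

/-- (CAP) If the door is injective then `dim F⁰Ext² ≤ rank M` (the rank of the map-free symbol matrix of the alphabet). -/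
theorem finrank_F0_le_finrank_range_M [FiniteDimensional K T] (hinj : Function.Injective D.door) :
    finrank K D.F0 ≤ finrank K (LinearMap.range D.M) := by
  have h1 : finrank K (LinearMap.range (D.M ∘ₗ D.symbol)) = finrank K D.F0 :=
    LinearMap.finrank_range_of_inj (D.injective_M_comp_symbol hinj)
  have h2 : LinearMap.range (D.M ∘ₗ D.symbol) ≤ LinearMap.range D.M := LinearMap.range_comp_le_range _ _
  calc finrank K D.F0 = finrank K (LinearMap.range (D.M ∘ₗ D.symbol)) := h1.symm
    _ ≤ finrank K (LinearMap.range D.M) := Submodule.finrank_mono h2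

/-- (CAP, numeric form) `rank M ≤ c` and door injective ⇒ `dim F⁰Ext² ≤ c`; with `c = 996` this is THEOREM BALANCED CAP's
consequence for door 3, with `c = 992` the one for the alphabets D★ ∕ S′ ∕ S131 of record. -/
theorem finrank_F0_le_of_cap [FiniteDimensional K T] (hinj : Function.Injective D.door) {c : ℕ}
    (hc : finrank K (LinearMap.range D.M) ≤ c) : finrank K D.F0 ≤ c :=
  (D.finrank_F0_le_finrank_range_M hinj).trans hc

/-- (CAP, symbol-space form) the rank of `M` is at most `dim S = 28·K`; so door 3 forces `dim F⁰Ext² ≤ 28·K`. -/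
theorem finrank_F0_le_finrank_S [FiniteDimensional K S] [FiniteDimensional K T] (hinj : Function.Injective D.door) :
    finrank K D.F0 ≤ finrank K S :=
  (D.finrank_F0_le_finrank_range_M hinj).trans (LinearMap.finrank_range_le D.M)

/-- Contrapositive (a DESIGN-LEVEL KILL SHAPE): if more independent display-induced classes survive than the symbol matrix can
separate, the door is not injective (door 3 fails at that `t`). -/
theorem not_injective_of_cap_lt [FiniteDimensional K T] {c : ℕ} (hc : finrank K (LinearMap.range D.M) ≤ c)
    (hbig : c < finrank K D.F0) : ¬ Function.Injective D.door := by
  intro hinj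
  exact absurd (D.finrank_F0_le_of_cap hinj hc) (not_le.mpr hbig)

end LetterSymbolDatum

end Shadow

section Arithmetic

/-- `H^{0,2}(X)` on the product of four surfaces: 4 pure + 6·4 mixed Künneth coordinates. -/
theorem dim_H02 : 4 * 1 + 6 * 4 = 28 := by norm_num

/-- `dim H^{3,5}(X) = C(8,3)·C(8,5) = 3136` (the (S-V) ceiling). -/
theorem dim_H35 : Nat.choose 8 3 * Nat.choose 8 5 = 3136 := by decide

/-- `dim R^{≤3} = 1 + 12 + 58 + 144 = 215` for `R = ⊗_f ℚ(i)[I_f, e_f, E_f]` (memo §2.1). -/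
theorem dim_R_le3 : 1 + 4 * 3 + (4 * 1 + 6 * 3 * 3) + (4 * 3 * 3 + 4 * 3 * 3 * 3) = 215 := by norm_num

/-- pure Künneth block of the universal symbol target: `dim R'^3` on three factors `= 6·3 + 27 = 45`. -/
theorem dim_pure_block : 3 * 2 * 3 + 3 * 3 * 3 = 45 := by norm_num

/-- mixed Künneth block of the universal symbol target (memo §2.2): `24 + 8 + 8 + 72 + 24 = 136`. -/
theorem dim_mixed_block : 2 * (2 * 2 * 3) + 2 * (2 * 2) + 2 * (2 * 2) + 2 * (2 * 2 * 3 * 3) + 2 * (2 * 2 * 3) = 136 := by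
  norm_num

/-- THEOREM BALANCED CAP, the number: `4·45 + 6·136 = 996 < 3136`. -/
theorem cap_universal : 4 * 45 + 6 * 136 = 996 ∧ 996 < 3136 := by norm_num

/-- null-cone alphabets (all program-M and MINT-S alphabets of record): pure blocks drop to 44, cap `992`. -/
theorem cap_nullcone : 4 * 44 + 6 * 136 = 992 := by norm_num

/-- the M1-class alphabets (a24-dblC3, a28-dblC4, a32-dblC5, flips): `4·44 + 4·135 + 2·134 = 984`. -/
theorem cap_M1class : 4 * 44 + (4 * 135 + 2 * 134) = 984 := by norm_num

/-- symbol space of D★'s alphabet: `K = 137` NS classes, `28·137 = 3836` symbol coordinates, of which the moment map sees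
`1524` and the door `992`; symbol defect `1524 − 992 = 532`; BF-invisible symbol directions `3836 − 1524 = 2312`. -/
theorem digits_Dstar : 28 * 137 = 3836 ∧ 1524 - 992 = 532 ∧ 3836 - 1524 = 2312 := by norm_num

/-- door-3 budget for D★ by filtration degree (memo §3): `e_∞^{2,0} = e_∞^{1,1} = 0`, `e_∞^{0,2} ≤ 992`, total `≤ 3136`, so the
deep part may use at most `3136 − e_∞^{0,2}`; at `E₁` the columns are `1528, 22232, 82816 | 131800, 83000` (sum `321376`). -/
theorem E1_Dstar : 1528 + 22232 + 82816 + 131800 + 83000 = 321376 ∧ 82816 - 992 = 81824 := by norm_num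

end Arithmetic

section NullRay

variable {R : Type*} [CommRing R]

/-- along a null direction (`n² = 0`) squares are affine. -/
theorem sq_nullRay (x n : R) (hn : n * n = 0) : (x + n) ^ 2 = x ^ 2 + 2 * x * n := by
  linear_combination hn

/-- along a null direction cubes are affine. -/
theorem cube_nullRay (x n : R) (hn : n * n = 0) : (x + n) ^ 3 = x ^ 3 + 3 * x ^ 2 * n := by
  linear_combination (3 * x + n) * hn

/-- LEMMA NULL-RAY (memo §1.5): a cubic `q(y) = a₀ + a₁y + a₂y² + a₃y³` with coefficients in the even cohomology ring is
AFFINE along a null ray: `q(x + n) = q(x) + n·q′(x)` when `n² = 0`. -/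
theorem cubic_nullRay_affine (a₀ a₁ a₂ a₃ x n : R) (hn : n * n = 0) :
    a₀ + a₁ * (x + n) + a₂ * (x + n) ^ 2 + a₃ * (x + n) ^ 3
      = (a₀ + a₁ * x + a₂ * x ^ 2 + a₃ * x ^ 3) + n * (a₁ + 2 * a₂ * x + 3 * a₃ * x ^ 2) := by
  linear_combination (a₂ + a₃ * (3 * x + n)) * hn

/-- NULL-RAY KERNEL for three collinear letters `x + λⱼ n` (`n² = 0`): symbol vectors with vanishing 0th and 1st moments along
the chain are killed by every affine function of the position, hence by `Q_t` (apply `cubic_nullRay_affine`). -/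
theorem nullRay_kernel₃ (A B n l₀ l₁ l₂ c₀ c₁ c₂ : R) (h0 : c₀ + c₁ + c₂ = 0) (h1 : l₀ * c₀ + l₁ * c₁ + l₂ * c₂ = 0) :
    c₀ * (A + l₀ * n * B) + c₁ * (A + l₁ * n * B) + c₂ * (A + l₂ * n * B) = 0 := by
  linear_combination A * h0 + n * B * h1

end NullRay

end HSemireg.C4LetterSymbol
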